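import Literature.IUT.HodgeArakelov.PlusMinusTowerCoverModel
import Literature.AnabelianGeometry.EtaleTheta.Discharge.Sec2Def21OfSetting

/-!
# B14 ↔ W3-L2-02 junction: the tower of record `PlusMinusTower.ofPiCHat` read against abc-iut-L2-d3's `PiCData` / Def. 2.1 model in `Π_C`

S. Mochizuki, *Inter-universal Teichmüller theory II*, kurims manuscript (Dec. 2020), §2, Def. 2.3 (i) p. 67 ([IUTchII] Def 2.3 (i), kurims p.67)
[claim: Mochizuki2012, status: disputed] (D-0012 claim key; series status DISPUTED — bookkeeping identities between two landed constructions;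
nothing of the series is asserted); [EtTh] Def. 2.1 p. 36 [cite: MochizukiEtTh2009, Def 2.1 p.36].  abc-iut cell, seat abc-iut-L6-t19 gen 5 (B14).
PROOF-ONLY (0 defs).

The [IUTchII] Def. 2.3 (i) tower of record `W := PlusMinusTower.ofPiCHat e C μ … hZ hN T` (p430122) lives in abc-iut-L2-d3's `Π_C := e.PiCHat`
(`MuTwoSettingPiCData`, p428742).  Read against abc-iut-L2-d3's [EtTh] §2 model objects in the same group:

* `ofPiCHat_aug_eq_augGK` — the tower's augmentation `Π̂^cor_v ↠ G_v` IS `e.piCData.augGK` (`rfl`), so `Δ̂^cor_v = Ker augGK = Δ_C`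
  (`ofPiCHat_deltaCorHat_eq_ker_augGK`, `rfl`);
* `ofPiCHat_pmHat_le_PiX`, `ofPiCHat_hat_le_PiX` — `Π̂_v ≤ Π̂^±_v ≤ Π_X = e.piCData.PiX`: the tower's `Π̂^±_v` IS abc-iut-L2-d3's Def. 2.1 model
  subgroup `Π_X̲ := cl toPiCHat(inclX Π^tp_X̲)` of `Sec2Def21OfSetting` (same term; their `closureXu_le_PiX`, `index_closureXu`, `isOpen_closureXu`,
  `closureXu_normal` apply to it BY NAME), and `Π̂_v = cl toPiCHat(inclX Π^tp_X̲̲)` is open too (`isOpen_hat_ofPiCHat`, their `isOpen_closure_map_inclX`).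

Nothing here takes a side on [IUTchIII] Cor. 3.12; typed ≠ proved.
-/

namespace Literature.IUT.HodgeArakelov

open Literature.AnabelianGeometry.EtaleTheta Literature.AnabelianGeometry.SemiGraphs

namespace PlusMinusTower

variable {p : ℕ} [Fact p.Prime] {M : MuTwoSetting p} (e : M.CLevelData)
  {E : M.toThetaSetting.EtaleThetaData} {l : ℕ} (C : E.DoubleUnderline l) {N : ℕ+}
  (μ : M.toThetaSetting.CyclotomeMod l N) (hC : M.toThetaSetting.Compat) (hS : M.toThetaSetting.Sec2Hyps)
  (hl : l.Prime) (hp2 : p ≠ 2) (hpl : p ≠ l) (hζ : ∃ ζ : M.toThetaSetting.K, IsPrimitiveRoot ζ (4 * l))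
  {η : (C.thetaEnvData μ hC hS).PiYdd → MuN p N} (hη : η ∈ (C.thetaEnvData μ hC hS).thetaCocycles)
  (hZ : Thm16Sub.KerToZIsCompactlyGenerated M.toThetaSetting) (hN : (C.Huu.subgroupOf (M.GtpXu l)).Normal)
  {P : TopGroup.{0}} (T : TemperedCoverings (BadPlaceSetting.ofUnderline C μ hC hS hl hp2 hpl hζ hη) P)

/-- **The tower's augmentation IS abc-iut-L2-d3's `augGK : Π_C ↠ G_K`** (both are `piCData.aug` co-restricted to `G_K`).  `rfl`.
([IUTchII] Def 2.3 (i), kurims p.67) [claim: Mochizuki2012, status: disputed] -/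
theorem ofPiCHat_aug_eq_augGK : (ofPiCHat e C μ hC hS hl hp2 hpl hζ hη hZ hN T).aug = e.piCData.augGK :=
  rfl

/-- **`Δ̂^cor_v = Δ_C := Ker augGK`** for the tower of record.  `rfl`. ([IUTchII] Def 2.3 (i), kurims p.67) [claim: Mochizuki2012, status: disputed] -/
theorem ofPiCHat_deltaCorHat_eq_ker_augGK :
    (ofPiCHat e C μ hC hS hl hp2 hpl hζ hη hZ hN T).deltaCorHat = e.piCData.augGK.ker :=
  rfl

/-- **`Π̂^±_v ≤ Π_X`**: the tower's `Π̂^±_v` is abc-iut-L2-d3's Def. 2.1 model subgroup `Π_X̲ = cl toPiCHat(inclX Π^tp_X̲)` (same term), which lies in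
`Π_X = piCData.PiX` (their `closureXu_le_PiX`).  PROVED. ([IUTchII] Def 2.3 (i), kurims p.67) [claim: Mochizuki2012, status: disputed] -/
theorem ofPiCHat_pmHat_le_PiX : (ofPiCHat e C μ hC hS hl hp2 hpl hζ hη hZ hN T).pmHat ≤ e.piCData.PiX :=
  e.closureXu_le_PiX e.toPiCHat e.isProfiniteCompletion_toPiCHat l

/-- **`Π̂_v ≤ Π_X`**.  PROVED. ([IUTchII] Def 2.3 (i), kurims p.67) [claim: Mochizuki2012, status: disputed] -/
theorem ofPiCHat_hat_le_PiX : (ofPiCHat e C μ hC hS hl hp2 hpl hζ hη hZ hN T).hat ≤ e.piCData.PiX :=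
  le_trans (ofPiCHat e C μ hC hS hl hp2 hpl hζ hη hZ hN T).hat_le_pmHat
    (ofPiCHat_pmHat_le_PiX e C μ hC hS hl hp2 hpl hζ hη hZ hN T)

/-- **`Π̂^±_v` is OPEN in `Π_C`** (print: "normal open subgroup"; abc-iut-L2-d3's `isOpen_closureXu` — the same subgroup).  PROVED.
([IUTchII] Def 2.3 (i), kurims p.67) [claim: Mochizuki2012, status: disputed] -/
theorem isOpen_pmHat_ofPiCHat :
    IsOpen (((((M.GtpXu l).map M.inclX).map e.toPiCHat.toMonoidHom).topologicalClosure : Subgroup e.PiCHat) : Set e.PiCHat) ∧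
      (ofPiCHat e C μ hC hS hl hp2 hpl hζ hη hZ hN T).pmHat =
        (((M.GtpXu l).map M.inclX).map e.toPiCHat.toMonoidHom).topologicalClosure :=
  ⟨e.isOpen_closureXu e.toPiCHat e.isProfiniteCompletion_toPiCHat C.l_ne_zero, rfl⟩

/-- **`Π̂_v` is OPEN in `Π_C`** (abc-iut-L2-d3's `isOpen_closure_map_inclX` at `H := Π^tp_X̲̲`, open of index `l²`).  PROVED.
([IUTchII] Def 2.3 (i), kurims p.67) [claim: Mochizuki2012, status: disputed] -/
theorem isOpen_hat_ofPiCHat :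
    IsOpen ((((C.Huu.map M.inclX).map e.toPiCHat.toMonoidHom).topologicalClosure : Subgroup e.PiCHat) : Set e.PiCHat) ∧
      (ofPiCHat e C μ hC hS hl hp2 hpl hζ hη hZ hN T).hat = ((C.Huu.map M.inclX).map e.toPiCHat.toMonoidHom).topologicalClosure := by
  haveI : C.Huu.FiniteIndex := ⟨by rw [C.index_Huu]; exact pow_ne_zero 2 C.l_ne_zero⟩
  exact ⟨e.isOpen_closure_map_inclX e.toPiCHat e.isProfiniteCompletion_toPiCHat C.Huu C.isOpen_Huu, rfl⟩

/-- **`[Π_C : Π̂^±_v] = 2l` and `Π̂^±_v ⊴ Π_C` read through abc-iut-L2-d3's lemmas** (`index_closureXu`; `closureXu_normal` fed with abc-iut-L6-t19's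
tempered normality `map_inclX_GtpXu_normal`, L02) — the same numbers as `ofPiCHat_indices` / the field `pmHat_normal`, by the other route.
PROVED. ([IUTchII] Def 2.3 (i), kurims p.67) [claim: Mochizuki2012, status: disputed] -/
theorem pmHat_ofPiCHat_via_closureXu :
    (ofPiCHat e C μ hC hS hl hp2 hpl hζ hη hZ hN T).pmHat.index = 2 * l ∧
      (ofPiCHat e C μ hC hS hl hp2 hpl hζ hη hZ hN T).pmHat.Normal :=
  ⟨e.index_closureXu e.toPiCHat e.isProfiniteCompletion_toPiCHat C.l_ne_zero,
    MuTwoSetting.CLevelData.closureXu_normal e.toPiCHat e.isProfiniteCompletion_toPiCHat l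
      (e.map_inclX_GtpXu_normal l hZ)⟩

end PlusMinusTower

end Literature.IUT.HodgeArakelov
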